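import Summits.CriticalPhenomena.PercolationContinuityZ3.Theorems.PercNearOneGluingNoHeavyLowerTailThresholdTwoFibreRel
import Mathlib.Algebra.BigOperators.Group.Finset.Basic
import Mathlib.Algebra.Order.BigOperators.Group.Finset
import Mathlib.Algebra.BigOperators.Ring.Finset
import Mathlib.Tactic.Ring
import Mathlib.Tactic.Linarith

/-!
# `NoHeavyLowerTail` (crux stmt-CriticalPhenomena-4575), lane prim-ineq-gen-4 (gen 17): bookkeeping for THREE-PARTITION POSITIVITY WITH THE
# THRESHOLD SLOT `Θ₂` — regrouping the pair counts over the spectator fibres, the `#Y = 2` fibre, the singleton identity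

Support file (`--supports stmt-CriticalPhenomena-4575`; memo `run/shared/lean/prim/prim-ineq-gen-4/FINDING-THRESHOLD-FIBREWISE-g17.md`, proof text
`PROOFS-THRESHOLD-TWO-g17.md`).  Pure finite combinatorics, no definitions, no `sorry`, standard axioms.

This file holds the counting infrastructure; the theorem itself (`thresholdTwo_counting`) is in `…ThresholdTwo`.  Its statement: let `V, W` be up-sets of finsets of a finite type with `n ≥ 4` points, `∅ ∉ V`, `∅ ∉ W`.  Counting ordered pairs
`(v, w) ∈ V × W` of DISJOINT finsets and pairs `(u, s)` with `u ∈ V ∩ W`, `s` disjoint from `u`: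
  `#{(v,w) : 2 ≤ #w} + #{(v,w) : 2 ≤ #v} + #{(u,s) : 2 ≤ #s} ≤ 2·#{(u,s) : 2 ≤ #u} + #{(v,w) : 2 ≤ #(v ∪ w)ᶜ}`.
By the kernel form of the lane's three-partition functional (memo §0(B); `dee(V, Θ₂∩W) + dee(W, Θ₂∩V) + dee(Θ₂, V∩W) ≤ 2·top(Θ₂∩V∩W) + tee(Θ₂,V,W)`)
this is `N(Θ₂, V, W) ≥ 0` — three-partition positivity with the threshold slot `Θ₂`, for all up-sets `V, W`, in every dimension (the cases
`n ≤ 3`, `V = ⊤` or `W = ⊤` being the tree's `threePartN_nonneg_of_card_le_four` / `threePartN_univ_nonneg`).  The bridge to `ThreePartition.threePartN`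
(sets of `Set ι` versus finsets) is not in this file.

PROOF = the spectator-by-spectator certificate of PROOFS-THRESHOLD-TWO-g17.md: every count is regrouped over the fibre `Y = v ∪ w` (resp. `Y = sᶜ ⊇ u`),
the diagonal weights are redistributed over the fibres with the weights `ν` of the memo (scaled by `n − 1`), and on each fibre the inequality is one of:
two graded Kleitmans (`#Yᶜ = 0`), + strict Kleitman (`#Yᶜ = 1`), (RAB₂) (`2 ≤ #Yᶜ ≤ n−2`, `#Y ≥ 3`), the `#Y = 2` fibre lemma, or trivial (`#Y ≤ 1`) —
all from `…ThresholdTwoFibreRel`.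
-/

namespace Summit.CriticalPhenomena.PercolationContinuityZ3.Theorems.ThresholdTwoFibre

open Finset

variable {α : Type*} [DecidableEq α] [Fintype α]

/-! ## Regrouping the pair counts over the fibre `Y = v ∪ w` (cross pairs) and `Y = sᶜ` (diagonal pairs) -/

/-- Cross pairs `(v,w)`, `v ∈ V`, `w ∈ W`, disjoint, with a property `R`, counted fibre by fibre over `Y = v ∪ w`
(inside the fibre, `z = w ⊆ Y` and `v = Y \ z`). [this work] -/
theorem card_crossPairs_eq_sum (V W : Finset (Finset α)) (R : Finset α × Finset α → Prop) [DecidablePred R] :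
    #((univ : Finset (Finset α × Finset α)).filter fun q => (q.1 ∈ V ∧ q.2 ∈ W ∧ Disjoint q.1 q.2) ∧ R q)
      = ∑ Y : Finset α, #(Y.powerset.filter fun z => (z ∈ W ∧ Y \ z ∈ V) ∧ R (Y \ z, z)) := by
  rw [card_eq_sum_card_fiberwise (f := fun q : Finset α × Finset α => q.1 ∪ q.2) (t := univ)
    (fun q _ => mem_coe.2 (mem_univ _))]
  refine sum_congr rfl fun Y _ => ?_
  refine card_bij (fun q _ => q.2) (fun q hq => ?_) (fun q hq q' hq' h => ?_) (fun z hz => ?_)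
  · simp only [mem_filter, mem_univ, true_and] at hq
    obtain ⟨⟨⟨hv, hw, hd⟩, hR⟩, hY⟩ := hq
    have h1 : Y \ q.2 = q.1 := by rw [← hY, union_sdiff_cancel_right hd]
    rw [mem_filter, mem_powerset, h1]
    exact ⟨hY ▸ subset_union_right, ⟨hw, hv⟩, hR⟩
  · simp only [mem_filter, mem_univ, true_and] at hq hq'
    have h1 : q.1 = q'.1 := by
      rw [← union_sdiff_cancel_right hq.1.1.2.2, ← union_sdiff_cancel_right hq'.1.1.2.2, hq.2, hq'.2, h]
    exact Prod.ext h1 h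
  · rw [mem_filter, mem_powerset] at hz
    refine ⟨(Y \ z, z), ?_, rfl⟩
    simp only [mem_filter, mem_univ, true_and]
    exact ⟨⟨⟨hz.2.1.2, hz.2.1.1, sdiff_disjoint⟩, hz.2.2⟩, sdiff_union_of_subset hz.1⟩

/-- `u` is disjoint from `Yᶜ` iff `u ⊆ Y`. [folklore] -/
theorem disjoint_compl_iff_subset (u Y : Finset α) : Disjoint u Yᶜ ↔ u ⊆ Y := by
  rw [disjoint_left]
  constructor
  · intro h x hx; by_contra hxY; exact h hx (mem_compl.2 hxY)
  · intro h x hx hxc; exact (mem_compl.1 hxc) (h hx)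

/-- Diagonal pairs `(u, s)`, `u ∈ V ∩ W`, `s` disjoint from `u`, with a property `R`, counted fibre by fibre over `Y = sᶜ`
(inside the fibre, `u ⊆ Y`). [this work] -/
theorem card_diagPairs_eq_sum (V W : Finset (Finset α)) (R : Finset α × Finset α → Prop) [DecidablePred R] :
    #((univ : Finset (Finset α × Finset α)).filter fun q => ((q.1 ∈ V ∧ q.1 ∈ W) ∧ Disjoint q.1 q.2) ∧ R q)
      = ∑ Y : Finset α, #(Y.powerset.filter fun u => (u ∈ W ∧ u ∈ V) ∧ R (u, Yᶜ)) := by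
  rw [card_eq_sum_card_fiberwise (f := fun q : Finset α × Finset α => q.2ᶜ) (t := univ)
    (fun q _ => mem_coe.2 (mem_univ _))]
  refine sum_congr rfl fun Y _ => ?_
  refine card_bij (fun q _ => q.1) (fun q hq => ?_) (fun q hq q' hq' h => ?_) (fun u hu => ?_)
  · simp only [mem_filter, mem_univ, true_and] at hq
    obtain ⟨⟨⟨⟨hv, hw⟩, hd⟩, hR⟩, hY⟩ := hq
    have h2 : q.2 = Yᶜ := by rw [← hY, compl_compl]
    rw [mem_filter, mem_powerset, ← disjoint_compl_iff_subset]
    have hq' : (q.1, Yᶜ) = q := by rw [← h2]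
    refine ⟨h2 ▸ hd, ⟨hw, hv⟩, ?_⟩
    rw [hq']; exact hR
  · simp only [mem_filter, mem_univ, true_and] at hq hq'
    have h2 : q.2 = q'.2 := by rw [← compl_compl q.2, ← compl_compl q'.2, hq.2, hq'.2]
    exact Prod.ext h h2
  · rw [mem_filter, mem_powerset] at hu
    refine ⟨(u, Yᶜ), ?_, rfl⟩
    simp only [mem_filter, mem_univ, true_and, compl_compl]
    exact ⟨⟨⟨⟨hu.2.1.2, hu.2.1.1⟩, (disjoint_compl_iff_subset u Y).2 hu.1⟩, hu.2.2⟩, trivial⟩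

omit [Fintype α] in
/-- **The fibre `#Y = 2`.**  For up-sets `W, V` and a finset `Y` with `#Y = 2`:
`#{i ∈ Y : {i} ∈ W ∩ V} ≤ #{u ⊆ Y : u ∈ W ∩ V, 2 ≤ #u} + #{z ⊆ Y : z ∈ W, Y \ z ∈ V, #z = 1}`. [this work] -/
theorem card_singletons_le_two_fibre (Y : Finset α) (W V : Finset (Finset α)) (hW : IsUpperSet (W : Set (Finset α)))
    (hV : IsUpperSet (V : Set (Finset α))) (hY : #Y = 2) :
    #(Y.filter fun i => ({i} : Finset α) ∈ W ∧ ({i} : Finset α) ∈ V)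
      ≤ #(Y.powerset.filter fun u => (u ∈ W ∧ u ∈ V) ∧ 2 ≤ #u)
        + #(Y.powerset.filter fun z => (z ∈ W ∧ Y \ z ∈ V) ∧ #z = 1) := by
  set I := Y.filter fun i => ({i} : Finset α) ∈ W ∧ ({i} : Finset α) ∈ V with hI
  by_cases hI0 : #I = 0
  · rw [hI0]; exact Nat.zero_le _
  obtain ⟨p, hp⟩ := card_pos.1 (Nat.pos_of_ne_zero hI0)
  have hp' := hp
  rw [hI, mem_filter] at hp'
  have hYmem : Y ∈ Y.powerset.filter fun u => (u ∈ W ∧ u ∈ V) ∧ 2 ≤ #u := by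
    rw [mem_filter, mem_powerset]
    have hsub : ({p} : Finset α) ⊆ Y := singleton_subset_iff.2 hp'.1
    exact ⟨subset_refl Y, ⟨hW hsub hp'.2.1, hV hsub hp'.2.2⟩, by omega⟩
  have h1 : 1 ≤ #(Y.powerset.filter fun u => (u ∈ W ∧ u ∈ V) ∧ 2 ≤ #u) := card_pos.2 ⟨Y, hYmem⟩
  have hIY : I ⊆ Y := filter_subset _ Y
  have hIle : #I ≤ 2 := hY ▸ card_le_card hIY
  by_cases hI1 : #I ≤ 1
  · omega
  · -- both points of Y are common singletons
    have hIeq : I = Y := eq_of_subset_of_card_le hIY (by omega)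
    have hall : ∀ i ∈ Y, ({i} : Finset α) ∈ W ∧ ({i} : Finset α) ∈ V := by
      intro i hi
      rw [← hIeq, hI, mem_filter] at hi
      exact hi.2
    have h2 : #I ≤ #(Y.powerset.filter fun z => (z ∈ W ∧ Y \ z ∈ V) ∧ #z = 1) := by
      rw [hIeq, ← card_image_of_injective Y (singleton_injective : Function.Injective fun i : α => ({i} : Finset α))]
      refine card_le_card fun z hz => ?_
      rw [mem_image] at hz
      obtain ⟨i, hi, rfl⟩ := hz
      rw [mem_filter, mem_powerset, card_singleton]
      have hc : #(Y \ {i}) = 1 := by rw [card_sdiff_of_subset (singleton_subset_iff.2 hi), hY, card_singleton]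
      obtain ⟨j, hj⟩ := card_eq_one.1 hc
      have hjY : j ∈ Y := by
        have : j ∈ Y \ {i} := by rw [hj]; exact mem_singleton_self j
        exact (mem_sdiff.1 this).1
      refine ⟨singleton_subset_iff.2 hi, ⟨(hall i hi).1, ?_⟩, rfl⟩
      rw [hj]; exact (hall j hjY).2
    omega


/-! ## Small counting facts -/

/-- `(if P then k else 0) · #{x ∈ s | Q x} = k · #{x ∈ s | Q x ∧ P}`. [folklore] -/
theorem ite_mul_card_filter {β : Type*} (s : Finset β) (Q : β → Prop) [DecidablePred Q] (P : Prop) [Decidable P] (k : ℕ) :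
    (if P then k else 0) * #(s.filter Q) = k * #(s.filter fun x => Q x ∧ P) := by
  by_cases hP : P
  · simp only [hP, if_true, and_true]
  · simp only [hP, if_false, zero_mul, and_false, filter_false, card_empty, mul_zero]

/-- `#{x ∈ s | Q x} = #{x ∈ s | Q x ∧ P x} + #{x ∈ s | Q x ∧ ¬ P x}`. [folklore] -/
theorem card_filter_split {β : Type*} (s : Finset β) (Q P : β → Prop) [DecidablePred Q] [DecidablePred P] :
    #(s.filter Q) = #(s.filter fun x => Q x ∧ P x) + #(s.filter fun x => Q x ∧ ¬ P x) := by
  rw [← filter_filter, ← filter_filter, card_filter_add_card_filter_not]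

/-- Members of `W ∩ V` of size one below `Y` are the common singletons `{i}`, `i ∈ Y`. [this work] -/
theorem card_filter_singletons_eq (Y : Finset α) (W V : Finset (Finset α)) :
    #(Y.powerset.filter fun u => (u ∈ W ∧ u ∈ V) ∧ #u = 1)
      = #(Y.filter fun i => ({i} : Finset α) ∈ W ∧ ({i} : Finset α) ∈ V) := by
  rw [← card_image_of_injective (Y.filter fun i => ({i} : Finset α) ∈ W ∧ ({i} : Finset α) ∈ V)
    (singleton_injective : Function.Injective fun i : α => ({i} : Finset α))]
  congr 1
  ext u
  simp only [mem_filter, mem_powerset, mem_image, card_eq_one]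
  constructor
  · rintro ⟨huY, ⟨huW, huV⟩, i, rfl⟩
    exact ⟨i, ⟨singleton_subset_iff.1 huY, huW, huV⟩, rfl⟩
  · rintro ⟨i, ⟨hiY, hiW, hiV⟩, rfl⟩
    exact ⟨singleton_subset_iff.2 hiY, ⟨hiW, hiV⟩, i, rfl⟩

/-- The singleton bookkeeping of the certificate: `(n−1) · #{({i}, {i}ᶜ)} = #{({i}, {j}) : j ≠ i}` over the common singletons `{i}`,
written as diagonal-pair counts. [this work] -/
theorem singleton_pairs_identity (V W : Finset (Finset α)) :
    (Fintype.card α - 1) * #((univ : Finset (Finset α × Finset α)).filter fun q =>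
        ((q.1 ∈ V ∧ q.1 ∈ W) ∧ Disjoint q.1 q.2) ∧ (#q.1 = 1 ∧ Fintype.card α - 1 ≤ #q.2))
      = #((univ : Finset (Finset α × Finset α)).filter fun q =>
        ((q.1 ∈ V ∧ q.1 ∈ W) ∧ Disjoint q.1 q.2) ∧ (#q.1 = 1 ∧ #q.2 = 1)) := by
  set I := (univ : Finset α).filter fun i => ({i} : Finset α) ∈ V ∧ ({i} : Finset α) ∈ W with hI
  -- the first count is `#I` via `i ↦ ({i}, {i}ᶜ)`
  have h1 : #((univ : Finset (Finset α × Finset α)).filter fun q =>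
      ((q.1 ∈ V ∧ q.1 ∈ W) ∧ Disjoint q.1 q.2) ∧ (#q.1 = 1 ∧ Fintype.card α - 1 ≤ #q.2)) = #I := by
    symm
    refine card_bij (fun i _ => (({i} : Finset α), ({i} : Finset α)ᶜ)) (fun i hi => ?_) (fun i hi j hj h => ?_)
      (fun q hq => ?_)
    · rw [hI, mem_filter] at hi
      simp only [mem_filter, mem_univ, true_and]
      refine ⟨⟨hi.2, disjoint_compl_right⟩, ?_, ?_⟩
      · rw [card_singleton]
      · rw [card_compl, card_singleton]
    · simp only [Prod.mk.injEq] at h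
      exact singleton_injective h.1
    · simp only [mem_filter, mem_univ, true_and] at hq
      obtain ⟨⟨⟨hV', hW'⟩, hd⟩, h1, h2⟩ := hq
      obtain ⟨i, hi⟩ := card_eq_one.1 h1
      refine ⟨i, ?_, ?_⟩
      · rw [hI, mem_filter]; exact ⟨mem_univ _, hi ▸ hV', hi ▸ hW'⟩
      · have hsub : q.2 ⊆ ({i} : Finset α)ᶜ := by
          intro x hx; rw [mem_compl, mem_singleton]; intro hxi
          rw [hxi] at hx
          exact disjoint_left.1 hd (hi ▸ mem_singleton_self i) hx
        have hc : #(({i} : Finset α)ᶜ) = Fintype.card α - 1 := by rw [card_compl, card_singleton]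
        have heq : q.2 = ({i} : Finset α)ᶜ := eq_of_subset_of_card_le hsub (by rw [hc]; exact h2)
        exact Prod.ext hi.symm heq.symm
  -- the second count is `#I · (n − 1)` via `(i, j) ↦ ({i}, {j})`, `j ≠ i`
  have h2 : #((univ : Finset (Finset α × Finset α)).filter fun q =>
      ((q.1 ∈ V ∧ q.1 ∈ W) ∧ Disjoint q.1 q.2) ∧ (#q.1 = 1 ∧ #q.2 = 1))
        = #((I ×ˢ (univ : Finset α)).filter fun ij => ij.1 ≠ ij.2) := by
    symm
    refine card_bij (fun ij _ => (({ij.1} : Finset α), ({ij.2} : Finset α))) (fun ij hij => ?_)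
      (fun ij hij ij' hij' h => ?_) (fun q hq => ?_)
    · rw [mem_filter, mem_product, hI, mem_filter] at hij
      simp only [mem_filter, mem_univ, true_and]
      refine ⟨⟨hij.1.1.2, ?_⟩, ?_, ?_⟩
      · rw [disjoint_singleton_left, mem_singleton]; exact hij.2
      · rw [card_singleton]
      · rw [card_singleton]
    · simp only [Prod.mk.injEq] at h
      exact Prod.ext (singleton_injective h.1) (singleton_injective h.2)
    · simp only [mem_filter, mem_univ, true_and] at hq
      obtain ⟨⟨⟨hV', hW'⟩, hd⟩, h1, h2⟩ := hq
      obtain ⟨i, hi⟩ := card_eq_one.1 h1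
      obtain ⟨j, hj⟩ := card_eq_one.1 h2
      refine ⟨(i, j), ?_, ?_⟩
      · rw [mem_filter, mem_product, hI, mem_filter]
        refine ⟨⟨⟨mem_univ _, hi ▸ hV', hi ▸ hW'⟩, mem_univ _⟩, ?_⟩
        rintro (rfl : i = j)
        exact disjoint_left.1 hd (hi ▸ mem_singleton_self i) (hj ▸ mem_singleton_self i)
      · exact Prod.ext hi.symm hj.symm
  rw [h1, h2]
  have h3 : #((I ×ˢ (univ : Finset α)).filter fun ij => ij.1 ≠ ij.2) = ∑ i ∈ I, #((univ : Finset α).erase i) := by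
    rw [card_eq_sum_card_fiberwise (f := fun ij : α × α => ij.1) (t := I) (fun ij hij => by
      rw [mem_coe, mem_filter, mem_product] at hij; exact mem_coe.2 hij.1.1)]
    refine sum_congr rfl fun i hi => ?_
    refine card_bij (fun ij _ => ij.2) (fun ij hij => ?_) (fun ij hij ij' hij' h => ?_) (fun j hj => ?_)
    · rw [mem_filter, mem_filter, mem_product] at hij
      rw [mem_erase]; exact ⟨fun h => hij.1.2 (hij.2.trans h.symm), mem_univ _⟩
    · rw [mem_filter] at hij hij'
      exact Prod.ext (hij.2.trans hij'.2.symm) h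
    · rw [mem_erase] at hj
      refine ⟨(i, j), ?_, rfl⟩
      rw [mem_filter, mem_filter, mem_product]
      exact ⟨⟨⟨hi, mem_univ _⟩, fun h => hj.1 h.symm⟩, rfl⟩
  rw [h3, Finset.sum_const_nat (fun i _ => by rw [card_erase_of_mem (mem_univ i), card_univ]), mul_comm]

end Summit.CriticalPhenomena.PercolationContinuityZ3.Theorems.ThresholdTwoFibre
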